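import Summits.QuantumFields.YangMills.Theorems.LuscherReductionDressedRitzPolyakovLiftQuasimodeBudget
import Summits.QuantumFields.YangMills.Theorems.LuscherReductionDressedRitzPolyakovLiftPScalingOfBudget
import Summits.QuantumFields.YangMills.Theorems.LuscherReductionDressedRitzPolyakovLiftGlue
import Summits.QuantumFields.YangMills.Theorems.LuscherReductionOneSiteLevelsClosed
import Literature.NumberTheory.LFunctions.PrimeReciprocalWindows
import HarnessLib

/-!
# Crux `DressedRitz` (stmt-QuantumFields-20205), line «polyakovlift» r5, stub S-PSCAL `stub_pscaling` (lane W1-A):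
# `ShadowBudgetAt k` — hence `PScalingExistsAt k` — FROM ONE QUASIMODE ESTIMATE PER SHADOW VECTOR

Support module (stub worker ym-20205-polyakovlift-w1a g0; `--supports stmt-QuantumFields-20205`, helper, no closure claim).  The lane's narrowed
target `PolyakovLift.ShadowBudgetAt k` (p541768) carries, per shadow vector and per pair, an eigenfamily, a pivot and two spectral budgets.  This
file reduces all of it to ONE inequality per channel — the shadow insertion is an `O(Λ²/L)·μ₀` QUASIMODE of the one-site transfer operator
`K_B` (`B = 2L³/Λ³`) at its `(i+1)`-st level:

* `DressedShadowQuasimodeAt k` — for some lift basis `(ω, g)` at `B₁ = 2/Λ³` and each `i < k` an approximate eigenvalue `a_i` with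
  `|a_i − μ_{i+1}(B)| ≤ C(Λ²/L)μ₀(B)` and `‖(K_B − a_i)w_i‖² ≤ (C(Λ²/L)μ₀)²‖w_i‖²` for the DRESSED shadow `w_i = shadowFamily B L e₀ g i`;
* `ShadowQuasimodeAt k` — the same for the UNDRESSED insertion `v_i = ins_{e₀}(g_i ∘ powLink L)` (the natural output of one-site semiclassics in
  two couplings: `v_i` = the `B`-model's `(i+1)`-st eigenfunction up to an `O(Λ)` correction of bounded energy, PSCAL-LEADING-ORDER.md);
* ★★ `shadowBudgetAt_of_dressedShadowQuasimode : DressedShadowQuasimodeAt k → ShadowBudgetAt k` — pivot `κ = μ_{i+1}(B)` (`C₁ = 0`), the family =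
  the exact dominating eigenfamily of the first `N(B)` levels with `μ_N ≤ μ₀/8` (`tendsto_levelValue_atTop_zero`), slow sum and cross sum by
  Cauchy–Schwarz (`ShadowQM.slowSum_le_of_quasimode`, `crossSum_le_of_quasimode`, Rayleigh quotient = residual minimiser), the remainder by
  `remainder_normSq_le_of_quasimode`; the crux ONE (`oneSiteLevels_proof`) supplies `μ_{i+1}(B) ≥ μ₀/2` for `L ≥ L0`; constants `C₂ = 16C`, `C₃ = 2C`;
* `budgetI_of_quasimode`, `budgetII_of_quasimode` — the two clauses for ONE vector ∕ ONE pair, any lattice size (the reusable press-buttons);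
* ★★ `pscalingExistsAt_of_dressedShadowQuasimode`; the vacuous level `k = 0`: `dressedShadowQuasimodeAt_zero`, `shadowBudgetAt_zero`
  (`exists_liftBasis`; `PScalingExistsAt 0` itself is cdisprove's `PolyakovLift.Negative.pscalingExistsAt_zero`).  The UNDRESSED ⟹ DRESSED
  step (`ShadowQuasimodeAt k → DressedShadowQuasimodeAt k`, dressing costs the constant `2e^{2(E+3)}` by `ShadowQM.dressed_quasimode_of_quasimode`
  and ONE) is the companion `…PolyakovLiftShadowQuasimodeUndressed.lean`.

WHAT REMAINS for S-PSCAL (= `stub_pscaling k` for `k ≥ 1`): `ShadowQuasimodeAt k` — pure one-site semiclassics in two couplings; NOT proved here.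
HONEST FRAMING: fixed-lattice spectral bookkeeping on the conditional femto rung R2b1 plus the closed crux ONE; no RG content; `stub_pscaling`
stays OPEN; no mass-gap ∕ continuum ∕ Clay claim follows from this stub or this file.  References: T. Kato, J. Phys. Soc. Japan 4 (1949) 334
[cite: Kato1949, §1]; M. Lüscher, NPB 219 (1983) 233 [cite: Luscher1983, §3].
-/

set_option autoImplicit false

noncomputable section

open MeasureTheory Filter Topology Real Finset
open Literature.MathematicalPhysics.QuantumFieldTheory (GaugeConfig Site gaugeTransform)
open scoped BigOperators

namespace Summit.QuantumFields.YangMills.Theorems.FemtoTransferGap.PolyakovLift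

open Summit.QuantumFields.YangMills.Theorems.FemtoTransferGap
open Summit.QuantumFields.YangMills.Theorems.FemtoTransferGap.LiftLeak
open Summit.QuantumFields.YangMills.Theorems.FemtoTransferGap.VacDict
open Summit.QuantumFields.YangMills.Theorems.FemtoTransferGap.ShadowQM

/-! ## §1 The two quasimode statements -/

/-- **`DressedShadowQuasimodeAt k`** — in the S-PSCAL frame (`Λ ∈ [lam,2lam]`, `lam ≤ lam0`, `L ≥ L0`, raw vacuum `e₀` of the `B = 2L³/Λ³` model)
some lift basis `(ω, g)` at `B₁ = 2/Λ³` whose DRESSED shadow vectors `w_i = shadowFamily B L e₀ g i` are quasimodes of `K_B`: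
`|a_i − μ_{i+1}(B)| ≤ C(Λ²/L)μ₀` and `‖K_B w_i − a_i w_i‖² ≤ (C(Λ²/L)μ₀)²‖w_i‖²`. [cite: Luscher1983, §3] -/
def DressedShadowQuasimodeAt (k : ℕ) : Prop :=
  ∃ C lam0 : ℝ, 0 ≤ C ∧ 0 < lam0 ∧ ∀ lam : ℝ, 0 < lam → lam ≤ lam0 → ∃ L0 : ℕ, ∀ L : ℕ, L0 ≤ L →
    ∀ Λ : ℝ, lam ≤ Λ → Λ ≤ 2 * lam →
      ∀ e₀ : GaugeConfig 3 1 SU2 → ℝ, IsRawVacuum (L := 1) (2 * (L : ℝ) ^ 3 / Λ ^ 3) e₀ →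
        ∃ (ω : GaugeConfig 3 1 SU2 → ℝ) (g : Fin k → (GaugeConfig 3 1 SU2 → ℝ)), LiftBasis (2 / Λ ^ 3) k ω g ∧
          let B : ℝ := 2 * (L : ℝ) ^ 3 / Λ ^ 3
          let w : Fin k → (GaugeConfig 3 1 SU2 → ℝ) := shadowFamily B L e₀ g
          let m0 := levelValue su2Rep 1 B 0
          ∀ i : Fin k, ∃ a : ℝ, |a - levelValue su2Rep 1 B ((i : ℕ) + 1)| ≤ C * (Λ ^ 2 / L) * m0 ∧
            l2 (transferApply B (w i) - a • w i) (transferApply B (w i) - a • w i) ≤ (C * (Λ ^ 2 / L) * m0) ^ 2 * l2 (w i) (w i)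

/-- **`ShadowQuasimodeAt k`** — the same for the UNDRESSED shadow insertions `v_i = ins_{e₀}(g_i ∘ powLink L)`: the `B₁`-eigen-ratio read on the
`L`-th powers of the links, vacuum-subtracted against `e₀`, is an `O(Λ²/L)μ₀`-quasimode of `K_B` at level `i+1` (what one-site semiclassics in two
couplings must deliver; `H_B(c) = (1/L)H_{B₁}(Lc)` at leading order). [cite: Luscher1983, §3] -/
def ShadowQuasimodeAt (k : ℕ) : Prop :=
  ∃ C lam0 : ℝ, 0 ≤ C ∧ 0 < lam0 ∧ ∀ lam : ℝ, 0 < lam → lam ≤ lam0 → ∃ L0 : ℕ, ∀ L : ℕ, L0 ≤ L →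
    ∀ Λ : ℝ, lam ≤ Λ → Λ ≤ 2 * lam →
      ∀ e₀ : GaugeConfig 3 1 SU2 → ℝ, IsRawVacuum (L := 1) (2 * (L : ℝ) ^ 3 / Λ ^ 3) e₀ →
        ∃ (ω : GaugeConfig 3 1 SU2 → ℝ) (g : Fin k → (GaugeConfig 3 1 SU2 → ℝ)), LiftBasis (2 / Λ ^ 3) k ω g ∧
          let B : ℝ := 2 * (L : ℝ) ^ 3 / Λ ^ 3
          let v : Fin k → (GaugeConfig 3 1 SU2 → ℝ) := fun i => OpPlat.ins e₀ (g i ∘ powLink L)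
          let m0 := levelValue su2Rep 1 B 0
          ∀ i : Fin k, ∃ a : ℝ, |a - levelValue su2Rep 1 B ((i : ℕ) + 1)| ≤ C * (Λ ^ 2 / L) * m0 ∧
            l2 (transferApply B (v i) - a • v i) (transferApply B (v i) - a • v i) ≤ (C * (Λ ^ 2 / L) * m0) ^ 2 * l2 (v i) (v i)

/-! ## §2 One-site inputs: the bare parameter of `B = 2L³/Λ³`, ONE's level law uniformly over the first `k+1` levels -/

/-- `bareLambda (2L³/Λ³) = Λ/L` (`Λ > 0`, `L ≥ 1`). [folklore] -/
theorem bareLambda_scaled {Λ : ℝ} (hΛ : 0 < Λ) {L : ℕ} (hL : 0 < L) :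
    bareLambda (2 * (L : ℝ) ^ 3 / Λ ^ 3) = Λ / L := by
  have hLr : (0 : ℝ) < L := Nat.cast_pos.mpr hL
  unfold bareLambda
  have hq : 2 / (2 * (L : ℝ) ^ 3 / Λ ^ 3) = (Λ / L) ^ 3 := by field_simp
  rw [hq]
  have h13 : ((1 : ℝ) / 3) = ((3 : ℕ) : ℝ)⁻¹ := by norm_num
  rw [h13]
  exact Real.pow_rpow_inv_natCast (div_nonneg hΛ.le hLr.le) (by norm_num)

/-- **ONE, uniformly over the first `k+1` levels**: there are `E ≥ 0` and `B0` with `e^{−Eλ_b}μ₀(B) ≤ μ_j(B) ≤ μ₀(B)` for all `j ≤ k`, `B ≥ B0`,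
`B > 0`, `λ_b = bareLambda B ≤ 1` (sum the per-level constants of `oneSiteLevels_proof`). [cite: Luscher1983, §2] -/
theorem exists_uniform_level_lower (k : ℕ) :
    ∃ E B0 : ℝ, 0 ≤ E ∧ 0 ≤ B0 ∧ ∀ B : ℝ, 0 < B → B0 ≤ B → bareLambda B ≤ 1 → ∀ j : ℕ, j ≤ k →
      Real.exp (-(E * bareLambda B)) * levelValue su2Rep 1 B 0 ≤ levelValue su2Rep 1 B j := by
  have hONE := oneSiteLevels_proof
  choose Cf B0f hf using hONE
  refine ⟨∑ j ∈ range (k + 1), (|levelGap j| + |Cf j|), ∑ j ∈ range (k + 1), |B0f j|,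
    sum_nonneg fun j _ => add_nonneg (abs_nonneg _) (abs_nonneg _), sum_nonneg fun j _ => abs_nonneg _,
    fun B hB hB0 hlb j hj => ?_⟩
  have hjm : j ∈ range (k + 1) := mem_range.mpr (Nat.lt_succ_of_le hj)
  have hB0j : B0f j ≤ B := by
    have h1 : |B0f j| ≤ ∑ i ∈ range (k + 1), |B0f i| := single_le_sum (fun i _ => abs_nonneg (B0f i)) hjm
    exact ((le_abs_self _).trans h1).trans hB0
  obtain ⟨hμ0, -, hlow⟩ := hf j B hB0j
  have hlb0 : 0 ≤ bareLambda B := (bareLambda_pos' hB).le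
  refine le_trans (mul_le_mul_of_nonneg_right (Real.exp_le_exp.mpr ?_) hμ0.le) hlow
  -- `−E λ ≤ −(ε_j λ + C_j λ²)`
  have h1 : |levelGap j| + |Cf j| ≤ ∑ i ∈ range (k + 1), (|levelGap i| + |Cf i|) :=
    single_le_sum (fun i _ => add_nonneg (abs_nonneg (levelGap i)) (abs_nonneg (Cf i))) hjm
  have h2 : levelGap j * bareLambda B + Cf j * bareLambda B ^ 2 ≤ (|levelGap j| + |Cf j|) * bareLambda B := by
    have hsq : bareLambda B ^ 2 ≤ bareLambda B := by nlinarith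
    nlinarith [le_abs_self (levelGap j), le_abs_self (Cf j), abs_nonneg (Cf j), mul_le_mul_of_nonneg_left hsq (abs_nonneg (Cf j))]
  nlinarith [mul_le_mul_of_nonneg_right h1 hlb0]

/-- Pure-real assembly of budget (i): slow sum `S`, remainder `Rm`, at smallness `Ct ≤ 1/32`. [folklore] -/
theorem budgetI_real {C t m0 W μ S Rm sQ sW d : ℝ} (hC : 0 ≤ C) (ht0 : 0 ≤ t) (hm0 : 0 < m0) (hCt : C * t ≤ 1 / 32)
    (hW0 : 0 ≤ W) (hμ0 : 0 ≤ μ) (hμhalf : m0 / 2 ≤ μ) (hd : d ≤ C * t * m0) (hS : S ≤ sQ * sW + d * W)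
    (hsq : sQ * sW ≤ C * t * m0 * W) (hRm : Rm ≤ 16 * (C * t) ^ 2 * W) :
    S + m0 * Rm ≤ (1 - Real.exp (-(16 * C * t))) * (μ * W) := by
  have h2 : m0 * Rm ≤ 2 * (C * t) * m0 * W := by
    have : 16 * (C * t) ^ 2 ≤ 2 * (C * t) := by nlinarith [mul_nonneg hC ht0]
    nlinarith [mul_nonneg hm0.le hW0, mul_le_mul_of_nonneg_left hRm hm0.le]
  have htot : S + m0 * Rm ≤ 4 * (C * t) * m0 * W := by nlinarith [mul_le_mul_of_nonneg_right hd hW0]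
  have hx0 : 0 ≤ 16 * C * t := by positivity
  have hx1 : 16 * C * t ≤ 1 := by nlinarith
  have hexp := Literature.NumberTheory.LFunctions.PrimeReciprocal.half_le_one_sub_exp_neg hx0 hx1
  calc S + m0 * Rm ≤ 4 * (C * t) * m0 * W := htot
    _ ≤ 8 * (C * t) * (μ * W) := by nlinarith [mul_nonneg (mul_nonneg hC ht0) hW0]
    _ ≤ (1 - Real.exp (-(16 * C * t))) * (μ * W) := mul_le_mul_of_nonneg_right (by linarith) (mul_nonneg hμ0 hW0)

/-- Pure-real assembly of budget (ii). [folklore] -/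
theorem budgetII_real {C t m0 X Y P : ℝ} (hX : X ≤ C * t * m0 * P) (hY : Y ≤ C * t * m0 * P) :
    X + Y ≤ 2 * C * t * m0 * P := by linarith

/-! ## §3 The two budget clauses of `ShadowBudgetAt` for ONE vector ∕ ONE pair from dressed quasimode data (any lattice size) -/

section Clauses

variable {M : ℕ} [NeZero M]

/-- ★ **Budget (i) of `ShadowBudgetAt` from a quasimode bound.**  `ψ` an exact physical `l2`-orthonormal eigenfamily (levels `ev`) dominating at
`Λd ≤ λ₀/8`; `w` physical with `‖(K_β − a)w‖² ≤ (Ctλ₀)²‖w‖²`, `|a − μ| ≤ Ctλ₀`, `λ₀/2 ≤ μ`, `Ct ≤ 1/32`.  Then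
`Σ_j|ev_j − μ|⟨w,ψ_j⟩² + λ₀‖w − Σ⟨w,ψ_j⟩ψ_j‖² ≤ (1 − e^{−16Ct})·μ‖w‖²`. [cite: Kato1949, §1] -/
theorem budgetI_of_quasimode {β : ℝ} {N : ℕ} {ψ : Fin N → (GaugeConfig 3 M SU2 → ℝ)} (hψ : ∀ j, IsPhys (ψ j))
    (hon : ∀ i l, l2 (ψ i) (ψ l) = if i = l then 1 else 0) (ev : Fin N → ℝ) (heig : ∀ j, transferApply β (ψ j) = ev j • ψ j)
    {Λd : ℝ} (hdom : ∀ φ : GaugeConfig 3 M SU2 → ℝ, IsPhys φ → (∀ j, l2 φ (ψ j) = 0) → l2 φ (transferApply β φ) ≤ Λd * l2 φ φ)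
    (hΛd : Λd ≤ levelValue su2Rep M β 0 / 8) (hm0 : 0 < levelValue su2Rep M β 0) {C t : ℝ} (hC : 0 ≤ C) (ht0 : 0 ≤ t)
    (hCt : C * t ≤ 1 / 32) {w : GaugeConfig 3 M SU2 → ℝ} (hw : IsPhys w) {a μ : ℝ} (hμhalf : levelValue su2Rep M β 0 / 2 ≤ μ)
    (haμ : |a - μ| ≤ C * t * levelValue su2Rep M β 0)
    (hq : l2 (transferApply β w - a • w) (transferApply β w - a • w) ≤ (C * t * levelValue su2Rep M β 0) ^ 2 * l2 w w) :
    ∑ j, |ev j - μ| * l2 w (ψ j) ^ 2 + levelValue su2Rep M β 0 * l2 (w - ∑ j, l2 w (ψ j) • ψ j) (w - ∑ j, l2 w (ψ j) • ψ j) ≤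
      (1 - Real.exp (-(16 * C * t))) * (μ * l2 w w) := by
  set m0 := levelValue su2Rep M β 0 with hm0def
  set W := l2 w w with hW
  set Q := l2 (transferApply β w - a • w) (transferApply β w - a • w) with hQ
  have hW0 : 0 ≤ W := l2_self_nonneg _
  have hμ0 : 0 ≤ μ := by linarith
  have hCtm : C * t * m0 ≤ m0 / 32 := by have := mul_le_mul_of_nonneg_right hCt hm0.le; linarith
  have ha_lb : 3 * m0 / 8 ≤ a := by have h1 := (abs_le.mp haμ).1; linarith
  have hΛa : Λd < a := by linarith
  have hsqrt : Real.sqrt Q * Real.sqrt W ≤ C * t * m0 * W := by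
    have h1 : Real.sqrt Q ≤ C * t * m0 * Real.sqrt W := by
      have := Real.sqrt_le_sqrt hq
      rwa [Real.sqrt_mul (sq_nonneg _), Real.sqrt_sq (by positivity)] at this
    calc Real.sqrt Q * Real.sqrt W ≤ C * t * m0 * Real.sqrt W * Real.sqrt W := mul_le_mul_of_nonneg_right h1 (Real.sqrt_nonneg _)
      _ = C * t * m0 * W := by rw [mul_assoc, Real.mul_self_sqrt hW0]
  have hslow := slowSum_le_of_quasimode β hψ hon ev heig hw a μ
  have hrem := remainder_normSq_le_of_quasimode β hψ hon ev heig hΛa hdom hw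
  have hrem' : l2 (w - ∑ j, l2 w (ψ j) • ψ j) (w - ∑ j, l2 w (ψ j) • ψ j) ≤ 16 * (C * t) ^ 2 * W := by
    refine hrem.trans ?_
    have hgap : m0 / 4 ≤ a - Λd := by linarith
    have hgap2 : (m0 / 4) ^ 2 ≤ (a - Λd) ^ 2 := pow_le_pow_left₀ (by positivity) hgap 2
    calc Q / (a - Λd) ^ 2 ≤ (C * t * m0) ^ 2 * W / (m0 / 4) ^ 2 := div_le_div₀ (by positivity) hq (by positivity) hgap2
      _ = 16 * (C * t) ^ 2 * W := by field_simp; ring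
  exact budgetI_real hC ht0 hm0 hCt hW0 hμ0 hμhalf haμ hslow hsqrt hrem'

/-- ★ **Budget (ii) of `ShadowBudgetAt` from two quasimode bounds** (midpoint pivot of the two Rayleigh quotients; same dominating family;
`‖w‖², ‖w′‖² > 0`): the cross sum plus `(λ₀ + |κ|)‖r‖‖r′‖` is `≤ 2Ctλ₀·‖w‖‖w′‖`. [cite: Kato1949, §1] -/
theorem budgetII_of_quasimode {β : ℝ} (hβ : 0 ≤ β) {N : ℕ} {ψ : Fin N → (GaugeConfig 3 M SU2 → ℝ)} (hψ : ∀ j, IsPhys (ψ j))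
    (hon : ∀ i l, l2 (ψ i) (ψ l) = if i = l then 1 else 0) (ev : Fin N → ℝ) (heig : ∀ j, transferApply β (ψ j) = ev j • ψ j)
    {Λd : ℝ} (hdom : ∀ φ : GaugeConfig 3 M SU2 → ℝ, IsPhys φ → (∀ j, l2 φ (ψ j) = 0) → l2 φ (transferApply β φ) ≤ Λd * l2 φ φ)
    (hΛd : Λd ≤ levelValue su2Rep M β 0 / 8) (hm0 : 0 < levelValue su2Rep M β 0) {C t : ℝ} (hC : 0 ≤ C) (ht0 : 0 ≤ t)
    (hCt : C * t ≤ 1 / 32) {w w' : GaugeConfig 3 M SU2 → ℝ} (hw : IsPhys w) (hw' : IsPhys w') (hw0 : 0 < l2 w w)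
    (hw0' : 0 < l2 w' w') {a b μa μb : ℝ} (hμa : levelValue su2Rep M β 0 / 2 ≤ μa) (hμb : levelValue su2Rep M β 0 / 2 ≤ μb)
    (ha : |a - μa| ≤ C * t * levelValue su2Rep M β 0) (hb : |b - μb| ≤ C * t * levelValue su2Rep M β 0)
    (hqa : l2 (transferApply β w - a • w) (transferApply β w - a • w) ≤ (C * t * levelValue su2Rep M β 0) ^ 2 * l2 w w)
    (hqb : l2 (transferApply β w' - b • w') (transferApply β w' - b • w') ≤ (C * t * levelValue su2Rep M β 0) ^ 2 * l2 w' w') :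
    let κ : ℝ := (l2 w (transferApply β w) / l2 w w + l2 w' (transferApply β w') / l2 w' w') / 2
    ∑ j, |ev j - κ| * |l2 w (ψ j) * l2 w' (ψ j)| +
        (levelValue su2Rep M β 0 + |κ|) *
          (Real.sqrt (l2 (w - ∑ j, l2 w (ψ j) • ψ j) (w - ∑ j, l2 w (ψ j) • ψ j)) *
            Real.sqrt (l2 (w' - ∑ j, l2 w' (ψ j) • ψ j) (w' - ∑ j, l2 w' (ψ j) • ψ j))) ≤
      2 * C * t * levelValue su2Rep M β 0 * (Real.sqrt (l2 w w) * Real.sqrt (l2 w' w')) := by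
  intro κ
  set m0 := levelValue su2Rep M β 0 with hm0def
  set Wi := l2 w w with hWi
  set Wl := l2 w' w' with hWl
  set ρi := l2 w (transferApply β w) / l2 w w with hρi
  set ρl := l2 w' (transferApply β w') / l2 w' w' with hρl
  have hWi0 : 0 ≤ Wi := l2_self_nonneg _
  have hWl0 : 0 ≤ Wl := l2_self_nonneg _
  have hCtm : C * t * m0 ≤ m0 / 32 := by have := mul_le_mul_of_nonneg_right hCt hm0.le; linarith
  have h32 : 32 * (C * t) ^ 2 ≤ C * t := by
    rw [sq]; have := mul_le_mul_of_nonneg_left hCt (mul_nonneg hC ht0); linarith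
  have ha_lb : 3 * m0 / 8 ≤ a := by have h1 := (abs_le.mp ha).1; linarith
  have hb_lb : 3 * m0 / 8 ≤ b := by have h1 := (abs_le.mp hb).1; linarith
  have hΛa : Λd < a := by linarith
  have hΛb : Λd < b := by linarith
  -- residual at the Rayleigh quotient ≤ residual at `a` ≤ (Ctλ₀)²‖w‖²
  have hQi : l2 (transferApply β w - ρi • w) (transferApply β w - ρi • w) ≤ (C * t * m0) ^ 2 * Wi :=
    (residual_rayleigh_le β hw hw0 a).trans hqa
  have hQl : l2 (transferApply β w' - ρl • w') (transferApply β w' - ρl • w') ≤ (C * t * m0) ^ 2 * Wl :=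
    (residual_rayleigh_le β hw' hw0' b).trans hqb
  have hsq : ∀ {Q W : ℝ}, 0 ≤ W → Q ≤ (C * t * m0) ^ 2 * W → Real.sqrt Q ≤ C * t * m0 * Real.sqrt W := fun hW h => by
    have := Real.sqrt_le_sqrt h
    rwa [Real.sqrt_mul (sq_nonneg _), Real.sqrt_sq (by positivity)] at this
  have hcross := crossSum_le_of_quasimode β hψ hon ev heig hw hw' ρi ρl
  have hcross' : ∑ j, |ev j - (ρi + ρl) / 2| * |l2 w (ψ j) * l2 w' (ψ j)| ≤ C * t * m0 * (Real.sqrt Wi * Real.sqrt Wl) := by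
    have h1 := mul_le_mul_of_nonneg_right (hsq hWi0 hQi) (Real.sqrt_nonneg Wl)
    have h2 := mul_le_mul_of_nonneg_left (hsq hWl0 hQl) (Real.sqrt_nonneg Wi)
    refine hcross.trans ?_
    have e1 : C * t * m0 * Real.sqrt Wi * Real.sqrt Wl = C * t * m0 * (Real.sqrt Wi * Real.sqrt Wl) := by ring
    have e2 : Real.sqrt Wi * (C * t * m0 * Real.sqrt Wl) = C * t * m0 * (Real.sqrt Wi * Real.sqrt Wl) := by ring
    linarith
  -- remainders
  have hbd : ∀ {Q W c : ℝ}, 0 ≤ W → Q ≤ (C * t * m0) ^ 2 * W → 3 * m0 / 8 ≤ c →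
      Q / (c - Λd) ^ 2 ≤ (4 * (C * t)) ^ 2 * W := fun {Q W c} hW hQ hc => by
    have hgap : m0 / 4 ≤ c - Λd := by linarith
    have hgap2 : (m0 / 4) ^ 2 ≤ (c - Λd) ^ 2 := pow_le_pow_left₀ (by positivity) hgap 2
    calc Q / (c - Λd) ^ 2 ≤ (C * t * m0) ^ 2 * W / (m0 / 4) ^ 2 := div_le_div₀ (by positivity) hQ (by positivity) hgap2
      _ = (4 * (C * t)) ^ 2 * W := by field_simp
  have hri := (remainder_normSq_le_of_quasimode β hψ hon ev heig hΛa hdom hw).trans (hbd hWi0 hqa ha_lb)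
  have hrl := (remainder_normSq_le_of_quasimode β hψ hon ev heig hΛb hdom hw').trans (hbd hWl0 hqb hb_lb)
  have hsr : ∀ {R W : ℝ}, 0 ≤ W → R ≤ (4 * (C * t)) ^ 2 * W → Real.sqrt R ≤ 4 * (C * t) * Real.sqrt W := fun hW h => by
    have := Real.sqrt_le_sqrt h
    rwa [Real.sqrt_mul (sq_nonneg _), Real.sqrt_sq (by positivity)] at this
  have hsri := hsr hWi0 hri
  have hsrl := hsr hWl0 hrl
  have hκ : |(ρi + ρl) / 2| ≤ m0 := by
    have h1 := abs_rayleigh_le_levelValue_zero (M := M) hβ hw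
    have h2 := abs_rayleigh_le_levelValue_zero (M := M) hβ hw'
    rw [abs_div, abs_two, div_le_iff₀ two_pos]
    linarith [abs_add_le ρi ρl]
  have hss : 0 ≤ Real.sqrt Wi * Real.sqrt Wl := mul_nonneg (Real.sqrt_nonneg _) (Real.sqrt_nonneg _)
  have hremtot : (m0 + |(ρi + ρl) / 2|) *
      (Real.sqrt (l2 (w - ∑ j, l2 w (ψ j) • ψ j) (w - ∑ j, l2 w (ψ j) • ψ j)) *
        Real.sqrt (l2 (w' - ∑ j, l2 w' (ψ j) • ψ j) (w' - ∑ j, l2 w' (ψ j) • ψ j))) ≤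
      C * t * m0 * (Real.sqrt Wi * Real.sqrt Wl) := by
    have h1 := mul_le_mul hsri hsrl (Real.sqrt_nonneg _) (by positivity)
    have h2 : m0 + |(ρi + ρl) / 2| ≤ 2 * m0 := by linarith
    calc _ ≤ 2 * m0 * ((4 * (C * t) * Real.sqrt Wi) * (4 * (C * t) * Real.sqrt Wl)) :=
          mul_le_mul h2 h1 (mul_nonneg (Real.sqrt_nonneg _) (Real.sqrt_nonneg _)) (by positivity)
      _ = 32 * (C * t) ^ 2 * m0 * (Real.sqrt Wi * Real.sqrt Wl) := by ring
      _ ≤ C * t * m0 * (Real.sqrt Wi * Real.sqrt Wl) :=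
          mul_le_mul_of_nonneg_right (mul_le_mul_of_nonneg_right h32 hm0.le) hss
  exact budgetII_real hcross' hremtot

end Clauses

/-! ## §4 ★★ Dressed quasimode ⟹ `ShadowBudgetAt` -/

/-- ★★ **`DressedShadowQuasimodeAt k → ShadowBudgetAt k`** (constants `C₁ = 0`, `C₂ = 16C`, `C₃ = 2C`; the SAME dominating exact eigenfamily of
the first `N(B)` levels, `μ_N ≤ μ₀/8`, serves every vector and every pair; `L0` raised until `C(Λ²/L) ≤ 1/32`, `λ_b ≤ 1` and ONE's
`μ_{i+1} ≥ μ₀/2`). [cite: Kato1949, §1] [cite: Luscher1983, §3] -/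
theorem shadowBudgetAt_of_dressedShadowQuasimode {k : ℕ} (h : DressedShadowQuasimodeAt k) : ShadowBudgetAt k := by
  classical
  obtain ⟨C, lam0, hC, hlam0, hk⟩ := h
  obtain ⟨E, B0, hE, hB0, hONE⟩ := exists_uniform_level_lower k
  refine ⟨0, 16 * C, 2 * C, lam0, le_rfl, by positivity, by positivity, hlam0, fun lam hlam hle => ?_⟩
  obtain ⟨L0, hL⟩ := hk lam hlam hle
  -- the threshold
  set R0 : ℝ := 4 * lam ^ 3 * B0 + 4 * E * lam + 128 * C * lam ^ 2 + 2 * lam + 1 with hR0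
  refine ⟨max L0 ⌈R0⌉₊, fun L hL0 Λ hlo hhi e₀ he₀ => ?_⟩
  have hLR : R0 ≤ (L : ℝ) := (Nat.le_ceil R0).trans (by exact_mod_cast (le_max_right _ _).trans hL0)
  have hl3 : 0 ≤ 4 * lam ^ 3 * B0 := by positivity
  have hl1 : 0 ≤ 4 * E * lam := by positivity
  have hl2 : 0 ≤ 128 * C * lam ^ 2 := by positivity
  have hLr1 : (1 : ℝ) ≤ L := by linarith
  have hLpos : 0 < L := Nat.cast_pos.mp (zero_lt_one.trans_le hLr1)
  have hLr : (0 : ℝ) < L := Nat.cast_pos.mpr hLpos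
  have hΛ : 0 < Λ := hlam.trans_le hlo
  obtain ⟨ω, g, hbasis, hq⟩ := hL L ((le_max_left _ _).trans hL0) Λ hlo hhi e₀ he₀
  have hBpos : 0 < 2 * (L : ℝ) ^ 3 / Λ ^ 3 := div_pos (mul_pos two_pos (pow_pos hLr 3)) (pow_pos hΛ 3)
  have hB1pos : 0 < 2 / Λ ^ 3 := div_pos two_pos (pow_pos hΛ 3)
  set B : ℝ := 2 * (L : ℝ) ^ 3 / Λ ^ 3 with hBdef
  set w : Fin k → (GaugeConfig 3 1 SU2 → ℝ) := shadowFamily B L e₀ g with hwdef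
  set m0 := levelValue su2Rep 1 B 0 with hm0
  set t : ℝ := Λ ^ 2 / L with ht
  have hm0pos : 0 < m0 := levelValue_su2Rep_pos (L := 1) hBpos 0
  have ht0 : 0 ≤ t := div_nonneg (sq_nonneg _) hLr.le
  have hg : ∀ i, IsPhys (g i) := hbasis.2.2.2.2.1
  have hw : ∀ i, IsPhys (w i) := fun i => by
    simp only [hwdef, shadowFamily, shadowVec]
    exact isPhys_iterate_transferApply B (OpPlat.isPhys_ins he₀.1 (isPhys_comp_powLink L (hg i))) _
  have hw0 : ∀ i, 0 < l2 (w i) (w i) := shadowFamily_o0 hBpos hB1pos hLpos he₀ hbasis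
  -- smallness of `C t`: `C Λ²/L ≤ 4 C lam²/L ≤ 1/32`
  have hCt : C * t ≤ 1 / 32 := by
    have h1 : Λ ^ 2 ≤ 4 * lam ^ 2 := by
      have := pow_le_pow_left₀ hΛ.le hhi 2; rw [mul_pow] at this; norm_num at this; linarith
    have h2 : C * t ≤ C * (4 * lam ^ 2) / L := by
      rw [ht, ← mul_div_assoc]; exact div_le_div_of_nonneg_right (mul_le_mul_of_nonneg_left h1 hC) hLr.le
    have h3 : C * (4 * lam ^ 2) / L ≤ 1 / 32 := by
      rw [div_le_iff₀ hLr]; linarith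
    exact h2.trans h3
  -- ONE at `B`: `λ_b = Λ/L ≤ 1`, `B ≥ B0`, `μ_j ≥ e^{−Eλ_b}μ₀ ≥ μ₀/2` for `j ≤ k`
  have hlb : bareLambda B = Λ / L := bareLambda_scaled hΛ hLpos
  have hΛL : Λ ≤ L := by linarith
  have hlb1 : bareLambda B ≤ 1 := by rw [hlb, div_le_one hLr]; exact hΛL
  have hBge : B0 ≤ B := by
    have h1 : Λ ^ 3 ≤ 8 * lam ^ 3 := by
      have := pow_le_pow_left₀ hΛ.le hhi 3; rw [mul_pow] at this; norm_num at this; linarith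
    have h2 : (L : ℝ) ≤ (L : ℝ) ^ 3 := le_self_pow₀ hLr1 (by norm_num)
    have h3 : 4 * lam ^ 3 * B0 ≤ L := by linarith
    rw [hBdef, le_div_iff₀ (pow_pos hΛ 3)]
    linarith [mul_le_mul_of_nonneg_left h1 hB0]
  have hElb : E * bareLambda B ≤ 1 / 2 := by
    rw [hlb]
    have h1 : E * (Λ / L) ≤ E * (2 * lam) / L := by
      rw [← mul_div_assoc]; exact div_le_div_of_nonneg_right (mul_le_mul_of_nonneg_left hhi hE) hLr.le
    have h2 : E * (2 * lam) / L ≤ 1 / 2 := by rw [div_le_iff₀ hLr]; linarith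
    exact h1.trans h2
  have hhalf : ∀ j : ℕ, j ≤ k → m0 / 2 ≤ levelValue su2Rep 1 B j := fun j hj => by
    have h1 := hONE B hBpos hBge hlb1 j hj
    have h2 : 1 / 2 ≤ Real.exp (-(E * bareLambda B)) := by
      have := Real.add_one_le_exp (-(E * bareLambda B)); linarith
    calc m0 / 2 = 1 / 2 * m0 := by ring
      _ ≤ Real.exp (-(E * bareLambda B)) * m0 := mul_le_mul_of_nonneg_right h2 hm0pos.le
      _ ≤ _ := h1
  -- the dominating family of the first `N` levels, `μ_N ≤ μ₀/8`
  obtain ⟨N, hN⟩ : ∃ N : ℕ, levelValue su2Rep 1 B N ≤ m0 / 8 := by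
    have hev := (tendsto_levelValue_atTop_zero (L := 1) hBpos).eventually (Iic_mem_nhds (show (0 : ℝ) < m0 / 8 by positivity))
    exact hev.exists
  obtain ⟨ψ, hψ, hon, heig0, hdom⟩ := exists_eigenfamily_dominating (L := 1) hBpos N
  obtain ⟨ev, hev⟩ : ∃ ev : Fin N → ℝ, ∀ j, ev j = levelValue su2Rep 1 B j := ⟨_, fun j => rfl⟩
  have heig : ∀ j, transferApply B (ψ j) = ev j • ψ j := fun j => by rw [hev]; exact heig0 j
  have hlev_le : ∀ j : ℕ, levelValue su2Rep 1 B j ≤ m0 := fun j => by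
    rw [hm0, levelValue_zero]; exact levelValue_su2Rep_le_topValue 1 B _
  refine ⟨ω, g, hbasis, fun i => ?_, fun i l hil => ?_⟩
  · -- (i) position budget with pivot `κ = μ_{i+1}`
    obtain ⟨a, ha1, ha2⟩ := hq i
    have hμhalf : m0 / 2 ≤ levelValue su2Rep 1 B ((i : ℕ) + 1) := hhalf _ (by have := i.2; omega)
    refine ⟨N, ψ, ev, levelValue su2Rep 1 B ((i : ℕ) + 1), hψ, hon, heig, by linarith, hlev_le _, by simp, by simp, ?_⟩
    have e : 16 * C * Λ ^ 2 / (L : ℝ) = 16 * C * t := by rw [ht]; ring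
    rw [e]
    exact budgetI_of_quasimode hψ hon ev heig hdom hN hm0pos hC ht0 hCt (hw i) hμhalf ha1 ha2
  · -- (ii) coupling budget with the midpoint pivot
    obtain ⟨a, ha1, ha2⟩ := hq i
    obtain ⟨b, hb1, hb2⟩ := hq l
    have hμi : m0 / 2 ≤ levelValue su2Rep 1 B ((i : ℕ) + 1) := hhalf _ (by have := i.2; omega)
    have hμl : m0 / 2 ≤ levelValue su2Rep 1 B ((l : ℕ) + 1) := hhalf _ (by have := l.2; omega)
    exact ⟨N, ψ, ev, hψ, hon, heig,
      budgetII_of_quasimode hBpos.le hψ hon ev heig hdom hN hm0pos hC ht0 hCt (hw i) (hw l) (hw0 i) (hw0 l) hμi hμl ha1 hb1 ha2 hb2⟩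

/-! ## §5 Corollaries: `PScalingExistsAt` from the dressed quasimode; the vacuous level `k = 0` -/

/-- ★★ `DressedShadowQuasimodeAt k → PScalingExistsAt k` (compose with the lead's `pscalingExistsAt_of_shadowBudget`). [cite: Luscher1983, §3] -/
theorem pscalingExistsAt_of_dressedShadowQuasimode {k : ℕ} (h : DressedShadowQuasimodeAt k) : PScalingExistsAt k :=
  pscalingExistsAt_of_shadowBudget (shadowBudgetAt_of_dressedShadowQuasimode h)

/-- `k = 0`: the dressed quasimode statement is vacuous (a lift basis exists, `exists_liftBasis`). [folklore] -/
theorem dressedShadowQuasimodeAt_zero : DressedShadowQuasimodeAt 0 := by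
  refine ⟨0, 1, le_rfl, one_pos, fun lam hlam _ => ⟨0, fun L _ Λ hlo _ e₀ _ => ?_⟩⟩
  have hΛ : 0 < Λ := hlam.trans_le hlo
  obtain ⟨ω, g, hb⟩ := exists_liftBasis (B := 2 / Λ ^ 3) (div_pos two_pos (pow_pos hΛ 3)) 0
  exact ⟨ω, g, hb, fun i => i.elim0⟩

/-- `ShadowBudgetAt 0` (and `PScalingExistsAt 0` = the tree's `PolyakovLift.Negative.pscalingExistsAt_zero`, cdisprove g2). [folklore] -/
theorem shadowBudgetAt_zero : ShadowBudgetAt 0 :=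
  shadowBudgetAt_of_dressedShadowQuasimode dressedShadowQuasimodeAt_zero

end Summit.QuantumFields.YangMills.Theorems.FemtoTransferGap.PolyakovLift

end
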